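import Literature.Barriers.RiemannHypothesis.NymanBeurlingObstructionsProofs
import HarnessLib

/-!
# Báez-Duarte 2000, Proposition 4.7 (`L²` clause) — proved: no fixed-coefficient series `∑_{k ≥ 2} c_k e_k` converges to `−χ` in `L²(0,1)`

Second sibling proof file of `Literature/Barriers/RiemannHypothesis/NymanBeurlingObstructions.lean`
(after `NymanBeurlingObstructionsProofs.lean`, which discharges Prop. 4.4 and the BDBLS bound): it
discharges the vendored no-go fact

* `Literature.Barriers.RiemannHypothesis.BaezDuarte2000_prop4_7` — for no coefficient sequence
  `(c_k)_{k ≥ 2}` (independent of `n`) do the partial sums `f_n = ∑_{k=2}^n c_k e_k`,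
  `e_k(x) = {1/(kx)} − (1/k){1/x}`, satisfy `‖χ + f_n‖_{L²(0,1)} → 0`,

as `Literature.Barriers.RiemannHypothesis.BaezDuarte2000_prop4_7_holds`, fully proved (no named
fact assumed; axioms ⊆ Mathlib's).

## Source and printed proof

L. Báez-Duarte, *Arithmetical aspects of Beurling's real variable reformulation of the Riemann
hypothesis*, arXiv:math/0011254 (2000), §4.2, pp. 11–12. Proposition 4.7: "No series in `𝒞^{nat}`
converges in `L_p(0,1)` to `−χ` if there is a zero of `ζ(s)` with real part `1/p`. In particular,
no series in `𝒞^{nat}` converges to `−χ` in `L₂(0,1)`." Printed proof: Lemma 4.2 — each `f_n ∈ 𝒞`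
is a step function constant on every `(1/(j+1), 1/j]`, so `L_p` convergence to `−χ` gives pointwise
convergence there, `f_n(1/j) → −1`, and an induction on `j` using `∑_{k ≤ j} μ(k)⌊j/k⌋ = 1` shows
that the coefficients of `ρ(1/(kx))` tend to `μ(k)`; the coefficients being independent of `n`,
`c_k = μ(k)` for all `k ≥ 2`, i.e. `f_n = V_n = ∑_{k=2}^n μ(k) e_k` (4.15); and `V_n` diverges in
`L_p` by Proposition 4.4 (`‖·‖ ≥ const · m^{1/q}|g(m)|`, `g(m) = ∑_{k ≤ m} μ(k)/k ≠ o(m^{-1/q})` by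
Cor. 2.1 when `ζ` has a zero on `Re s = 1/p`; unconditional for `p = 2`).

## The argument here (same mechanism, everything on `(0,1)`)

1. (`nbChi_add_natSeriesPartial_eq_of_mem`) On `I_j = (1/(j+1), 1/j)`, `j ≥ 1`:
   `{1/x} = 1/x − j`, `{1/(kx)} = 1/(kx) − ⌊j/k⌋`, `χ = 1`, so `χ + f_n` is the constant
   `A_n(j) = 1 + ∑_{k=2}^n c_k (j/k − ⌊j/k⌋)`.
2. (`tendsto_seriesStep_of_tendsto`) `‖χ + f_n‖_{L²(0,1)} ≥ |A_n(j)| · |I_j|^{1/2}`, so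
   `‖χ + f_n‖ → 0` forces `A_n(j) → 0` for every `j` (the "pointwise convergence" of the source).
3. (`sum_mul_nat_div_eq_of_tendsto`, `coeff_eq_moebius_of_tendsto`) For `n ≥ j`,
   `A_n(j) = 1 + j T_n − ∑_{k=2}^{j} c_k⌊j/k⌋` with `T_n = ∑_{k=2}^n c_k/k`; `j = 1` gives
   `T_n → −1`, whence `∑_{k=2}^{j} c_k⌊j/k⌋ = 1 − j` for all `j ≥ 1`; against
   `∑_{k=1}^{j} μ(k)⌊j/k⌋ = 1` a strong induction gives `c_k = μ(k)`, `k ≥ 2` (Lemma 4.2).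
4. (`nbChi_add_natSeriesPartial_moebius_eq`, `ofReal_le_eLpNorm_nbChi_add_natSeriesPartial_moebius`)
   With Möbius coefficients `χ + f_n = χ + V_n = g(n)⌊1/x⌋` on `(1/n, 1)`, hence
   `|χ + V_n| ≥ |g(n)| n/4` on `(1/n, 2/n)` (`n ≥ 4`) and `‖χ + V_n‖_{L²(0,1)} ≥ |g(n)|√n/4`
   (the `(0,1)`-version of (4.15), `‖χ + S_n‖₂ ≥ |g(n)|√n`).
5. (`BaezDuarte2000_prop4_7_holds`) So `‖χ + f_n‖ → 0` would give `|g(n)|√n → 0`, contradicting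
   Cor. 2.1 (`p = 2`), PROVED in the tree as
   `Literature.NumberTheory.LFunctions.not_tendsto_abs_sum_moebius_div_mul_sqrt`
   (`MertensOmegaSqrt.lean`, from a kernel-checked zero of `ζ` on `Re s = ½`).

## References

* [BaezDuarte2000] L. Báez-Duarte, *Arithmetical aspects of Beurling's real variable reformulation
  of the Riemann hypothesis*, arXiv:math/0011254 (2000), §4.2 pp. 11–12: Prop. 4.7, Lemma 4.2,
  (4.14)–(4.21), with proofs; §4.2 p. 11 Prop. 4.4 (proof); §2.2 Cor. 2.1 (read).
-/

noncomputable section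

open MeasureTheory Filter Set
open scoped Topology ENNReal ArithmeticFunction.Moebius

namespace Literature.Barriers.RiemannHypothesis

/-! ## Two small `L²` tools -/

/-- If `a ≤ |h|` on a measurable set `E` of measure `m`, then `a√m ≤ ‖h‖_{L²(μ)}`
(`‖𝟙_E a‖₂ = a μ(E)^{1/2}` and monotonicity of the seminorm). [folklore] -/
theorem ofReal_mul_sqrt_le_eLpNorm {ν : Measure ℝ} {E : Set ℝ} (hE : MeasurableSet E) {m : ℝ}
    (hm : 0 ≤ m) (hνE : ν E = ENNReal.ofReal m) {h : ℝ → ℝ} {a : ℝ} (ha : 0 ≤ a)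
    (hle : ∀ x ∈ E, a ≤ |h x|) : ENNReal.ofReal (a * Real.sqrt m) ≤ eLpNorm h 2 ν := by
  calc ENNReal.ofReal (a * Real.sqrt m)
      = ‖a‖ₑ * ν E ^ (1 / (2 : ℝ≥0∞).toReal) := by
        rw [hνE, ENNReal.toReal_ofNat, Real.enorm_eq_ofReal ha, Real.sqrt_eq_rpow,
          ENNReal.ofReal_rpow_of_nonneg hm (by norm_num), ENNReal.ofReal_mul ha]
    _ = eLpNorm (E.indicator fun _ ↦ a) 2 ν :=
        (eLpNorm_indicator_const hE (by norm_num) (by norm_num)).symm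
    _ ≤ eLpNorm h 2 ν := by
        refine eLpNorm_mono fun x ↦ ?_
        by_cases hx : x ∈ E
        · rw [indicator_of_mem hx, Real.norm_eq_abs, Real.norm_eq_abs, abs_of_nonneg ha]
          exact hle x hx
        · rw [indicator_of_notMem hx, norm_zero]
          exact norm_nonneg _

/-- Squeeze: if `a_n s ≤ e_n` eventually (`s > 0`, `a_n ≥ 0`) and `e_n → 0` in `ℝ≥0∞`, then
`a_n → 0`. [folklore] -/
theorem tendsto_zero_of_ofReal_mul_le {e : ℕ → ℝ≥0∞} {a : ℕ → ℝ} {s : ℝ} (hs : 0 < s)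
    (ha : ∀ n, 0 ≤ a n) (hle : ∀ᶠ n in atTop, ENNReal.ofReal (a n * s) ≤ e n)
    (he : Tendsto e atTop (𝓝 0)) : Tendsto a atTop (𝓝 0) := by
  rw [ENNReal.tendsto_nhds_zero] at he
  rw [Metric.tendsto_nhds]
  intro ε hε
  have hev := he (ENNReal.ofReal (ε / 2 * s)) (by simpa using mul_pos (half_pos hε) hs)
  filter_upwards [hev, hle] with n hn hn'
  have h1 := hn'.trans hn
  rw [ENNReal.ofReal_le_ofReal_iff (by positivity)] at h1
  have h2 : a n ≤ ε / 2 := le_of_mul_le_mul_right h1 hs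
  rw [Real.dist_eq, sub_zero, abs_of_nonneg (ha n)]
  linarith

/-! ## The step structure of `χ + f_n` on `I_j = (1/(j+1), 1/j)` (Lemma 4.2) -/

/-- For `x ∈ I_j = (1/(j+1), 1/j)` (`j ≥ 1`): `0 < x < 1` and `j < 1/x < j + 1`. [folklore] -/
theorem one_div_mem_of_mem_stepIoo {j : ℕ} (hj : 1 ≤ j) {x : ℝ}
    (hx : x ∈ Ioo (1 / ((j : ℝ) + 1)) (1 / (j : ℝ))) :
    0 < x ∧ x < 1 ∧ (j : ℝ) < 1 / x ∧ 1 / x < (j : ℝ) + 1 := by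
  have hj0 : (0 : ℝ) < j := by exact_mod_cast hj
  obtain ⟨hx1, hx2⟩ := hx
  have hx0 : 0 < x := lt_trans (by positivity) hx1
  refine ⟨hx0, ?_, ?_, ?_⟩
  · calc x < 1 / (j : ℝ) := hx2
      _ ≤ 1 := by rw [div_le_one hj0]; exact_mod_cast hj
  · rw [lt_div_iff₀ hx0]
    calc (j : ℝ) * x < j * (1 / j) := by gcongr
      _ = 1 := by field_simp
  · rw [div_lt_iff₀ hx0]
    calc (1 : ℝ) = ((j : ℝ) + 1) * (1 / ((j : ℝ) + 1)) := by field_simp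
      _ < ((j : ℝ) + 1) * x := by gcongr

/-- For `j < t < j + 1` and `k ≥ 1`: `⌊t/k⌋ = ⌊j/k⌋` (`⌊j/k⌋ ≤ j/k < t/k < (j+1)/k ≤ ⌊j/k⌋ + 1`,
the last step being `j + 1 ≤ k(⌊j/k⌋ + 1)`). [folklore] -/
theorem floor_div_eq_nat_div {j k : ℕ} (hk : 1 ≤ k) {t : ℝ} (ht1 : (j : ℝ) < t)
    (ht2 : t < (j : ℝ) + 1) : ⌊t / k⌋ = ((j / k : ℕ) : ℤ) := by
  have hk0 : (0 : ℝ) < k := by exact_mod_cast hk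
  rw [Int.floor_eq_iff]
  constructor
  · calc (((j / k : ℕ) : ℤ) : ℝ) = ((j / k : ℕ) : ℝ) := by norm_cast
      _ ≤ (j : ℝ) / k := Nat.cast_div_le
      _ ≤ t / k := by gcongr
  · have h1 : j + 1 ≤ k * (j / k + 1) := Nat.lt_mul_div_succ j hk
    have h2 : (j : ℝ) + 1 ≤ k * (((j / k : ℕ) : ℝ) + 1) := by exact_mod_cast h1
    calc t / k < ((j : ℝ) + 1) / k := by gcongr
      _ ≤ (k * (((j / k : ℕ) : ℝ) + 1)) / k := by gcongr
      _ = ((j / k : ℕ) : ℝ) + 1 := by field_simp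
      _ = (((j / k : ℕ) : ℤ) : ℝ) + 1 := by norm_cast

/-- On `I_j`: `{1/(kx)} = 1/(kx) − ⌊j/k⌋` for `k ≥ 1` (with `k = 1`: `{1/x} = 1/x − j`).
[cite: BaezDuarte2000, Lemma 4.2 (proof), p. 11] -/
theorem fract_one_div_mul_of_mem {j : ℕ} (hj : 1 ≤ j) {k : ℕ} (hk : 1 ≤ k) {x : ℝ}
    (hx : x ∈ Ioo (1 / ((j : ℝ) + 1)) (1 / (j : ℝ))) :
    Int.fract (1 / ((k : ℝ) * x)) = 1 / ((k : ℝ) * x) - ((j / k : ℕ) : ℝ) := by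
  obtain ⟨-, -, ht1, ht2⟩ := one_div_mem_of_mem_stepIoo hj hx
  have hkx : 1 / ((k : ℝ) * x) = (1 / x) / k := by rw [div_div, mul_comm]
  rw [hkx, ← Int.self_sub_floor, floor_div_eq_nat_div hk ht1 ht2, Int.cast_natCast]

/-- On `I_j` (`j ≥ 1`), `χ = 1`. [folklore] -/
theorem nbChi_eq_one_of_mem {j : ℕ} (hj : 1 ≤ j) {x : ℝ}
    (hx : x ∈ Ioo (1 / ((j : ℝ) + 1)) (1 / (j : ℝ))) : nbChi x = 1 := by
  obtain ⟨hx0, hx1, -, -⟩ := one_div_mem_of_mem_stepIoo hj hx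
  unfold nbChi
  rw [indicator_of_mem (show x ∈ Ioc (0 : ℝ) 1 from ⟨hx0, hx1.le⟩), Pi.one_apply]

/-- On `I_j` (`j ≥ 1`), `e_k(x) = {1/(kx)} − (1/k){1/x}` is the constant `j/k − ⌊j/k⌋` (`k ≥ 1`): the
step-function structure behind (4.19). [cite: BaezDuarte2000, Lemma 4.2 (proof), (4.19), p. 11] -/
theorem beurlingE_eq_of_mem {j : ℕ} (hj : 1 ≤ j) {k : ℕ} (hk : 1 ≤ k) {x : ℝ}
    (hx : x ∈ Ioo (1 / ((j : ℝ) + 1)) (1 / (j : ℝ))) :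
    beurlingE k x = (j : ℝ) / k - ((j / k : ℕ) : ℝ) := by
  have h1 := fract_one_div_mul_of_mem hj le_rfl hx
  rw [Nat.cast_one, one_mul, Nat.div_one] at h1
  unfold beurlingE beurlingRho
  rw [one_mul, h1, fract_one_div_mul_of_mem hj hk hx]
  ring

/-- **`χ + f_n` is the constant `1 + ∑_{k=2}^n c_k (j/k − ⌊j/k⌋)` on `I_j`** (`j ≥ 1`).
[cite: BaezDuarte2000, Lemma 4.2 (proof), (4.19), p. 11] -/
theorem nbChi_add_natSeriesPartial_eq_of_mem (c : ℕ → ℝ) (n : ℕ) {j : ℕ} (hj : 1 ≤ j) {x : ℝ}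
    (hx : x ∈ Ioo (1 / ((j : ℝ) + 1)) (1 / (j : ℝ))) :
    nbChi x + natSeriesPartial c n x =
      1 + ∑ k ∈ Finset.Icc 2 n, c k * ((j : ℝ) / k - ((j / k : ℕ) : ℝ)) := by
  rw [nbChi_eq_one_of_mem hj hx, natSeriesPartial]
  congr 1
  refine Finset.sum_congr rfl fun k hk ↦ ?_
  rw [beurlingE_eq_of_mem hj (le_trans one_le_two (Finset.mem_Icc.1 hk).1) hx]

/-- `I_j ⊆ (0,1)` has Lebesgue measure `1/j − 1/(j+1)`. [folklore] -/
theorem volume_restrict_stepIoo {j : ℕ} (hj : 1 ≤ j) :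
    (volume.restrict (Ioo (0 : ℝ) 1)) (Ioo (1 / ((j : ℝ) + 1)) (1 / (j : ℝ))) =
      ENNReal.ofReal (1 / (j : ℝ) - 1 / ((j : ℝ) + 1)) := by
  have hsub : Ioo (1 / ((j : ℝ) + 1)) (1 / (j : ℝ)) ⊆ Ioo 0 1 := by
    intro x hx
    obtain ⟨hx0, hx1, -, -⟩ := one_div_mem_of_mem_stepIoo hj hx
    exact ⟨hx0, hx1⟩
  rw [Measure.restrict_apply measurableSet_Ioo, inter_eq_self_of_subset_left hsub, Real.volume_Ioo]

/-- **From `L²(0,1)` convergence to convergence of the step values** ("for the step functions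
involved this clearly implies pointwise convergence"): if `‖χ + f_n‖_{L²(0,1)} → 0` then
`1 + ∑_{k=2}^n c_k (j/k − ⌊j/k⌋) → 0` for every `j ≥ 1`, since
`‖χ + f_n‖ ≥ |1 + ∑ …| · |I_j|^{1/2}`. [cite: BaezDuarte2000, Prop. 4.7 (proof), p. 12] -/
theorem tendsto_seriesStep_of_tendsto {c : ℕ → ℝ}
    (hconv : Tendsto (fun n ↦ eLpNorm (fun x ↦ nbChi x + natSeriesPartial c n x) 2
      (volume.restrict (Ioo 0 1))) atTop (𝓝 0)) {j : ℕ} (hj : 1 ≤ j) :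
    Tendsto (fun n ↦ 1 + ∑ k ∈ Finset.Icc 2 n, c k * ((j : ℝ) / k - ((j / k : ℕ) : ℝ)))
      atTop (𝓝 0) := by
  have hj0 : (0 : ℝ) < j := by exact_mod_cast hj
  have hm0 : 0 < 1 / (j : ℝ) - 1 / ((j : ℝ) + 1) := by
    rw [sub_pos]
    exact one_div_lt_one_div_of_lt hj0 (lt_add_one _)
  have hle : ∀ n, ENNReal.ofReal (|1 + ∑ k ∈ Finset.Icc 2 n, c k * ((j : ℝ) / k - ((j / k : ℕ) : ℝ))|
      * Real.sqrt (1 / (j : ℝ) - 1 / ((j : ℝ) + 1))) ≤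
      eLpNorm (fun x ↦ nbChi x + natSeriesPartial c n x) 2 (volume.restrict (Ioo 0 1)) := by
    intro n
    refine ofReal_mul_sqrt_le_eLpNorm measurableSet_Ioo hm0.le (volume_restrict_stepIoo hj)
      (abs_nonneg _) fun x hx ↦ ?_
    rw [nbChi_add_natSeriesPartial_eq_of_mem c n hj hx]
  have h := tendsto_zero_of_ofReal_mul_le (Real.sqrt_pos.2 hm0) (fun n ↦ abs_nonneg _)
    (Eventually.of_forall hle) hconv
  exact (tendsto_zero_iff_abs_tendsto_zero _).2 h

/-! ## Lemma 4.2 for fixed coefficients: `c_k = μ(k)` -/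

/-- For `n ≥ j`: `1 + ∑_{k=2}^n c_k (j/k − ⌊j/k⌋) = 1 + j ∑_{k=2}^n c_k/k − ∑_{k=2}^{j} c_k⌊j/k⌋`
(the `⌊j/k⌋` with `k > j` vanish) — (4.21) evaluated on `I_j`, with `a_{n,1} = −∑_{k=2}^n c_k/k`.
[cite: BaezDuarte2000, Prop. 4.7 (proof), (4.21), p. 12] -/
theorem seriesStep_eq {c : ℕ → ℝ} {n j : ℕ} (hjn : j ≤ n) :
    1 + ∑ k ∈ Finset.Icc 2 n, c k * ((j : ℝ) / k - ((j / k : ℕ) : ℝ)) =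
      1 + (j : ℝ) * ∑ k ∈ Finset.Icc 2 n, c k / k -
        ∑ k ∈ Finset.Icc 2 j, c k * ((j / k : ℕ) : ℝ) := by
  have hvanish : ∑ k ∈ Finset.Icc 2 n, c k * ((j / k : ℕ) : ℝ) =
      ∑ k ∈ Finset.Icc 2 j, c k * ((j / k : ℕ) : ℝ) := by
    rw [← Finset.sum_subset (Finset.Icc_subset_Icc_right hjn)]
    intro k hk hk'
    rw [Finset.mem_Icc] at hk hk'
    have hlt : j < k := by
      by_contra hle
      exact hk' ⟨hk.1, not_lt.1 hle⟩
    rw [Nat.div_eq_of_lt hlt, Nat.cast_zero, mul_zero]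
  rw [← hvanish, Finset.mul_sum, add_sub_assoc, ← Finset.sum_sub_distrib]
  congr 1
  refine Finset.sum_congr rfl fun k _ ↦ ?_
  ring

/-- **(4.19)–(4.20) for a series with fixed coefficients.** If the step values tend to `0` for every
`j ≥ 1`, then `∑_{k=2}^{j} c_k⌊j/k⌋ = 1 − j` for every `j ≥ 1`: `j = 1` gives
`∑_{k=2}^n c_k/k → −1` (i.e. `a_{n,1} → 1 = μ(1)`), and then the eventually affine expression of
`seriesStep_eq` has limit `1 − j − ∑_{k=2}^{j} c_k⌊j/k⌋ = 0`.
[cite: BaezDuarte2000, Lemma 4.2 (proof), (4.19)–(4.20), pp. 11–12] -/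
theorem sum_mul_nat_div_eq_of_tendsto {c : ℕ → ℝ}
    (hA : ∀ j : ℕ, 1 ≤ j → Tendsto
      (fun n ↦ 1 + ∑ k ∈ Finset.Icc 2 n, c k * ((j : ℝ) / k - ((j / k : ℕ) : ℝ))) atTop (𝓝 0))
    {j : ℕ} (hj : 1 ≤ j) :
    ∑ k ∈ Finset.Icc 2 j, c k * ((j / k : ℕ) : ℝ) = 1 - j := by
  -- `T_n = ∑_{k=2}^n c_k/k → -1`, from `j = 1`
  have hT : Tendsto (fun n ↦ ∑ k ∈ Finset.Icc 2 n, c k / k) atTop (𝓝 (-1)) := by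
    have h1 : Tendsto (fun n ↦ 1 + ∑ k ∈ Finset.Icc 2 n, c k / k) atTop (𝓝 0) := by
      refine (hA 1 le_rfl).congr fun n ↦ ?_
      congr 1
      refine Finset.sum_congr rfl fun k hk ↦ ?_
      have hk2 : 2 ≤ k := (Finset.mem_Icc.1 hk).1
      rw [Nat.div_eq_of_lt (by omega : 1 < k), Nat.cast_zero, sub_zero, Nat.cast_one, mul_one_div]
    have h2 := h1.sub_const 1
    simp only [add_sub_cancel_left, zero_sub] at h2
    exact h2
  have hlim : Tendsto (fun n ↦ 1 + ∑ k ∈ Finset.Icc 2 n, c k * ((j : ℝ) / k - ((j / k : ℕ) : ℝ)))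
      atTop (𝓝 (1 + (j : ℝ) * (-1) - ∑ k ∈ Finset.Icc 2 j, c k * ((j / k : ℕ) : ℝ))) := by
    refine (((hT.const_mul (j : ℝ)).const_add 1).sub_const _).congr' ?_
    filter_upwards [eventually_ge_atTop j] with n hn
    exact (seriesStep_eq hn).symm
  have huniq := tendsto_nhds_unique (hA j hj) hlim
  linarith

/-- **Lemma 4.2 / proof of Proposition 4.7: the coefficients are forced, `c_k = μ(k)` for all
`k ≥ 2`** — the triangular system `∑_{k=2}^{j} c_k⌊j/k⌋ = 1 − j` (`j ≥ 1`) against the classical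
`∑_{k=1}^{j} μ(k)⌊j/k⌋ = 1`, by strong induction on `j` ("this Lemma shows the inevitability of the
natural approximation `S_n`", Remark 4.7). [cite: BaezDuarte2000, Lemma 4.2 and Prop. 4.7 (proof), pp. 11–12] -/
theorem coeff_eq_moebius_of_tendsto {c : ℕ → ℝ}
    (hA : ∀ j : ℕ, 1 ≤ j → Tendsto
      (fun n ↦ 1 + ∑ k ∈ Finset.Icc 2 n, c k * ((j : ℝ) / k - ((j / k : ℕ) : ℝ))) atTop (𝓝 0))
    {k : ℕ} (hk : 2 ≤ k) : c k = μ k := by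
  -- the Möbius side: `∑_{k=2}^{j} μ(k)⌊j/k⌋ = 1 - j`
  have hμ : ∀ j : ℕ, 1 ≤ j → ∑ k ∈ Finset.Icc 2 j, (μ k : ℝ) * ((j / k : ℕ) : ℝ) = 1 - j := by
    intro j hj
    have h := sum_moebius_mul_div_eq_one hj
    rw [show Finset.Ioc 0 j = Finset.Icc 1 j from (Finset.Icc_add_one_left_eq_Ioc 0 j).symm,
      Finset.Icc_eq_cons_Ioc hj, Finset.sum_cons,
      show Finset.Ioc 1 j = Finset.Icc 2 j from (Finset.Icc_add_one_left_eq_Ioc 1 j).symm,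
      ArithmeticFunction.moebius_apply_one, Int.cast_one, one_mul, Nat.div_one] at h
    linarith
  -- the `c` side, and the vanishing of the differences
  have hd : ∀ j : ℕ, 1 ≤ j → ∑ k ∈ Finset.Icc 2 j, (c k - μ k) * ((j / k : ℕ) : ℝ) = 0 := by
    intro j hj
    simp only [sub_mul, Finset.sum_sub_distrib, sum_mul_nat_div_eq_of_tendsto hA hj, hμ j hj,
      sub_self]
  -- strong induction: `c k = μ k` for all `2 ≤ k ≤ m`
  have hind : ∀ m : ℕ, ∀ k, 2 ≤ k → k ≤ m → c k - μ k = 0 := by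
    intro m
    induction m with
    | zero => intro k hk hk0; omega
    | succ m ih =>
      intro k hk hkm
      rcases Nat.lt_or_ge k (m + 1) with hlt | hge
      · exact ih k hk (Nat.lt_succ_iff.1 hlt)
      · have hkeq : k = m + 1 := le_antisymm hkm hge
        subst hkeq
        have h := hd (m + 1) (by omega)
        rw [Finset.sum_Icc_succ_top (by omega : 2 ≤ m + 1), Nat.div_self (by omega : 0 < m + 1),
          Nat.cast_one, mul_one] at h
        have hzero : ∑ k ∈ Finset.Icc 2 m, (c k - μ k) * (((m + 1) / k : ℕ) : ℝ) = 0 :=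
          Finset.sum_eq_zero fun k hk ↦ by
            rw [ih k (Finset.mem_Icc.1 hk).1 (Finset.mem_Icc.1 hk).2, zero_mul]
        linarith
  exact sub_eq_zero.1 (hind k k hk le_rfl)

/-! ## With `c_k = μ(k)`: `χ + V_n = g(n)⌊1/x⌋` on `(1/n, 1)` and the `L²(0,1)` lower bound -/

/-- **`χ + V_n = g(n)⌊1/x⌋` on `(1/n, 1)`** (`n ≥ 1`, `V_n = ∑_{k=2}^n μ(k) e_k`, (4.15)): for `x`
there and `t = 1/x ∈ (1, n)`, `∑_{k ≤ n} μ(k)⌊t/k⌋ = 1`, so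
`∑_{k=2}^n μ(k)({t/k} − {t}/k) = ⌊t⌋(g(n) − 1) − (1 − ⌊t⌋) = ⌊t⌋ g(n) − 1`.
[cite: BaezDuarte2000, Prop. 4.4 (proof) and (4.15), p. 11] -/
theorem nbChi_add_natSeriesPartial_moebius_eq {n : ℕ} (hn : 1 ≤ n) {x : ℝ}
    (hx : x ∈ Ioo (1 / (n : ℝ)) 1) :
    nbChi x + natSeriesPartial (fun k ↦ (μ k : ℝ)) n x = moebiusHarmonic n * ⌊1 / x⌋ := by
  have hn0 : (0 : ℝ) < n := by exact_mod_cast hn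
  obtain ⟨hxn, hx1⟩ := hx
  have hx0 : 0 < x := lt_trans (by positivity) hxn
  have ht1 : 1 < 1 / x := by rw [lt_div_iff₀ hx0, one_mul]; exact hx1
  have htn : 1 / x < n := by
    rw [div_lt_iff₀ hx0]
    calc (1 : ℝ) = n * (1 / (n : ℝ)) := by field_simp
      _ < n * x := by gcongr
  have hfloor : ⌊1 / x⌋₊ ≤ n := Nat.floor_le_of_le htn.le
  -- `χ = 1`
  have hchi : nbChi x = 1 := by
    unfold nbChi
    rw [indicator_of_mem (show x ∈ Ioc (0 : ℝ) 1 from ⟨hx0, hx1.le⟩), Pi.one_apply]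
  -- `∑_{k=2}^n μ(k)/k = g(n) - 1`
  have hS1 : ∑ k ∈ Finset.Icc 2 n, (μ k : ℝ) / k = moebiusHarmonic n - 1 := by
    rw [moebiusHarmonic, Finset.Icc_eq_cons_Ioc hn, Finset.sum_cons,
      show Finset.Ioc 1 n = Finset.Icc 2 n from (Finset.Icc_add_one_left_eq_Ioc 1 n).symm,
      ArithmeticFunction.moebius_apply_one, Int.cast_one, Nat.cast_one, div_one]
    ring
  -- `∑_{k=2}^n μ(k)⌊t/k⌋ = 1 - ⌊t⌋`
  have hS2 : ∑ k ∈ Finset.Icc 2 n, (μ k : ℝ) * (⌊1 / x / k⌋ : ℝ) = 1 - ⌊1 / x⌋ := by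
    have h := sum_moebius_mul_floor_div_eq (le_of_lt (lt_trans one_pos ht1)) hfloor
    rw [if_pos ht1.le,
      show Finset.Ioc 0 n = Finset.Icc 1 n from (Finset.Icc_add_one_left_eq_Ioc 0 n).symm,
      Finset.Icc_eq_cons_Ioc hn, Finset.sum_cons,
      show Finset.Ioc 1 n = Finset.Icc 2 n from (Finset.Icc_add_one_left_eq_Ioc 1 n).symm,
      ArithmeticFunction.moebius_apply_one, Int.cast_one, Nat.cast_one, div_one, one_mul] at h
    linarith
  -- the summands
  have hsum : natSeriesPartial (fun k ↦ (μ k : ℝ)) n x =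
      ⌊1 / x⌋ * ∑ k ∈ Finset.Icc 2 n, (μ k : ℝ) / k -
        ∑ k ∈ Finset.Icc 2 n, (μ k : ℝ) * (⌊1 / x / k⌋ : ℝ) := by
    rw [natSeriesPartial, Finset.mul_sum, ← Finset.sum_sub_distrib]
    refine Finset.sum_congr rfl fun k _ ↦ ?_
    have hkx : 1 / ((k : ℝ) * x) = 1 / x / k := by rw [div_div, mul_comm]
    unfold beurlingE beurlingRho
    rw [one_mul, hkx, ← Int.self_sub_floor, ← Int.self_sub_floor]
    ring
  rw [hchi, hsum, hS1, hS2]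
  ring

/-- `y/4 · √(1/y) = √y · (1/4)` for `y > 0`. [folklore] -/
theorem div_four_mul_sqrt_one_div {y : ℝ} (hy : 0 < y) :
    y / 4 * Real.sqrt (1 / y) = Real.sqrt y * (1 / 4) := by
  have hs : Real.sqrt y ≠ 0 := (Real.sqrt_pos.2 hy).ne'
  calc y / 4 * Real.sqrt (1 / y) = Real.sqrt y * Real.sqrt y / 4 * (Real.sqrt y)⁻¹ := by
        rw [Real.mul_self_sqrt hy.le, one_div, Real.sqrt_inv]
    _ = Real.sqrt y * (1 / 4) := by field_simp

/-- **The `L²(0,1)` lower bound for `V_n`**: for `n ≥ 4`, `‖χ + V_n‖_{L²(0,1)} ≥ |g(n)|√n/4`, from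
`|χ + V_n| = |g(n)|⌊1/x⌋ ≥ |g(n)| n/4` on `(1/n, 2/n)` (measure `1/n`). (The printed bound, for
`S_n` on `(1/m, ∞)`, is `‖χ + S_m‖_p^p ≥ m^{p−1}|g(m)|^p/(p−1)`, (4.15).)
[cite: BaezDuarte2000, Prop. 4.4 (proof), (4.14)–(4.15), p. 11] -/
theorem ofReal_le_eLpNorm_nbChi_add_natSeriesPartial_moebius {n : ℕ} (hn : 4 ≤ n) :
    ENNReal.ofReal (|moebiusHarmonic n| * Real.sqrt n * (1 / 4)) ≤
      eLpNorm (fun x ↦ nbChi x + natSeriesPartial (fun k ↦ (μ k : ℝ)) n x) 2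
        (volume.restrict (Ioo 0 1)) := by
  have hn0 : (0 : ℝ) < n := by exact_mod_cast (lt_of_lt_of_le (by norm_num) hn)
  have hn1 : 1 ≤ n := by omega
  have h4 : (4 : ℝ) ≤ n := by exact_mod_cast hn
  have h2n : 2 / (n : ℝ) ≤ 1 := by rw [div_le_one hn0]; linarith
  have hsub : Ioo (1 / (n : ℝ)) (2 / (n : ℝ)) ⊆ Ioo 0 1 := fun x hx ↦
    ⟨lt_trans (by positivity) hx.1, lt_of_lt_of_le hx.2 h2n⟩
  have hμE : (volume.restrict (Ioo (0 : ℝ) 1)) (Ioo (1 / (n : ℝ)) (2 / (n : ℝ))) =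
      ENNReal.ofReal (1 / (n : ℝ)) := by
    rw [Measure.restrict_apply measurableSet_Ioo, inter_eq_self_of_subset_left hsub, Real.volume_Ioo]
    congr 1
    ring
  have hval : ∀ x ∈ Ioo (1 / (n : ℝ)) (2 / (n : ℝ)),
      |moebiusHarmonic n| * ((n : ℝ) / 4) ≤
        |nbChi x + natSeriesPartial (fun k ↦ (μ k : ℝ)) n x| := by
    intro x hx
    have hx0 : 0 < x := lt_trans (by positivity) hx.1
    have hx' : x ∈ Ioo (1 / (n : ℝ)) 1 := ⟨hx.1, lt_of_lt_of_le hx.2 h2n⟩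
    have hfl0 : (0 : ℝ) ≤ ⌊1 / x⌋ := by exact_mod_cast Int.floor_nonneg.2 (by positivity)
    rw [nbChi_add_natSeriesPartial_moebius_eq hn1 hx', abs_mul, abs_of_nonneg hfl0]
    gcongr
    -- `⌊1/x⌋ > 1/x - 1 > n/2 - 1 ≥ n/4`
    have h1 : (n : ℝ) / 2 < 1 / x := by
      rw [lt_div_iff₀ hx0]
      calc (n : ℝ) / 2 * x < (n : ℝ) / 2 * (2 / n) := by gcongr; exact hx.2
        _ = 1 := by field_simp
    have h2 : (1 / x : ℝ) < ⌊1 / x⌋ + 1 := Int.lt_floor_add_one _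
    linarith
  rw [mul_assoc, ← div_four_mul_sqrt_one_div hn0, ← mul_assoc]
  exact ofReal_mul_sqrt_le_eLpNorm measurableSet_Ioo (by positivity) hμE (by positivity) hval

/-! ## The discharge -/

/-- **Báez-Duarte 2000, Proposition 4.7 (`L²` clause), proved**: no series `f_n = ∑_{k=2}^n c_k e_k`
with coefficients independent of `n` satisfies `‖χ + f_n‖_{L²(0,1)} → 0`. Proof: the step values
`1 + ∑_{k=2}^n c_k(j/k − ⌊j/k⌋)` of `χ + f_n` on `I_j` tend to `0` (`tendsto_seriesStep_of_tendsto`),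
forcing `c_k = μ(k)` (`coeff_eq_moebius_of_tendsto`, Lemma 4.2), i.e. `f_n = V_n`; then
`‖χ + V_n‖_{L²(0,1)} ≥ |g(n)|√n/4` (`ofReal_le_eLpNorm_nbChi_add_natSeriesPartial_moebius`) and
`|g(n)|√n ↛ 0` (Cor. 2.1 with `p = 2`, the tree's
`Literature.NumberTheory.LFunctions.not_tendsto_abs_sum_moebius_div_mul_sqrt`).
[cite: BaezDuarte2000, Prop. 4.7, p. 11] -/
theorem BaezDuarte2000_prop4_7_holds : BaezDuarte2000_prop4_7 := by
  intro c hconv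
  -- Step 1: the step values tend to `0`, so `c_k = μ(k)` for `k ≥ 2`
  have hA : ∀ j : ℕ, 1 ≤ j → Tendsto
      (fun n ↦ 1 + ∑ k ∈ Finset.Icc 2 n, c k * ((j : ℝ) / k - ((j / k : ℕ) : ℝ))) atTop (𝓝 0) :=
    fun j hj ↦ tendsto_seriesStep_of_tendsto hconv hj
  have hc : ∀ k, 2 ≤ k → c k = μ k := fun k hk ↦ coeff_eq_moebius_of_tendsto hA hk
  -- Step 2: hence `f_n = V_n`
  have hfun : ∀ n, (fun x ↦ nbChi x + natSeriesPartial c n x) =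
      fun x ↦ nbChi x + natSeriesPartial (fun k ↦ (μ k : ℝ)) n x := by
    intro n
    funext x
    simp only [natSeriesPartial]
    congr 1
    exact Finset.sum_congr rfl fun k hk ↦ by rw [hc k (Finset.mem_Icc.1 hk).1]
  have hconv' : Tendsto (fun n ↦ eLpNorm
      (fun x ↦ nbChi x + natSeriesPartial (fun k ↦ (μ k : ℝ)) n x) 2
      (volume.restrict (Ioo 0 1))) atTop (𝓝 0) :=
    hconv.congr fun n ↦ by rw [hfun n]
  -- Step 3: `|g(n)|√n → 0`, contradicting Cor. 2.1 (`p = 2`)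
  have hle : ∀ᶠ n in atTop, ENNReal.ofReal (|moebiusHarmonic n| * Real.sqrt n * (1 / 4)) ≤
      eLpNorm (fun x ↦ nbChi x + natSeriesPartial (fun k ↦ (μ k : ℝ)) n x) 2
        (volume.restrict (Ioo 0 1)) := by
    filter_upwards [eventually_ge_atTop 4] with n hn
    exact ofReal_le_eLpNorm_nbChi_add_natSeriesPartial_moebius hn
  have h0 := tendsto_zero_of_ofReal_mul_le (by norm_num : (0 : ℝ) < 1 / 4)
    (fun n ↦ by positivity) hle hconv'
  exact Literature.NumberTheory.LFunctions.not_tendsto_abs_sum_moebius_div_mul_sqrt h0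

end Literature.Barriers.RiemannHypothesis
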